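import Summits.QuantumFields.YangMills.Theorems.WeakCouplingRatesHarmonicInteriorGradient
import Literature.Probability.LatticeModels.DirichletLatticeGFF
import Literature.Probability.LatticeModels.LatticeGreenGradient
import HarnessLib

/-!
# Crux `UVSeamRec` (stmt-QuantumFields-20043), line «coldwall_pure», stub `stub_dirichletRate`: the GAUSSIAN CALIBRATION of the Dirichlet rate —
# the Dirichlet finite-size shift of the bond covariance of the massless lattice GFF of `ℤ⁴` at distance `R` from the boundary is `O(R⁻⁴)`

Helper file (`--supports stmt-QuantumFields-20043`) of the LEAD seat `ym-spine-20043-p1` (gen 11).  The (DR) stub of line «coldwall_pure» (ym-idea-10)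
asserts the rate `R⁻⁴` for the centre-plane mean of a cold-wall cube; its card cites only a numerical one-loop calibration (LEAD kit j285022).  Here is
the THEOREM for the Gaussian caricature — the massless lattice Gaussian free field with zero boundary condition (tree `DirichletLatticeGFF.latticeGFF`,
covariance `β⁻¹ G_S`, `G_S = (−Δ_D)⁻¹` = `dirichletGreen S`):

* **`dirichletGreen_bond_shift_le`** — there is `C > 0` such that for every `R ≥ 8`, every finite `S ⊂ ℤ⁴` containing the sup-norm cube of radius
  `R + 1` around `c`, and every axis `j`:
  `|[G_S(c,c) + G_S(c+eⱼ,c+eⱼ) − 2G_S(c,c+eⱼ)] − [G(0) − G(eⱼ)]| ≤ C/R⁴`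
  (`G = latticeGreen`, twice the Green function of `−Δ`; `G(0) − G(eⱼ)` is the infinite-volume bond variance `2G₀(0) − 2G₀(eⱼ)`).
  PROOF: the image function `h_y(z) = G₀(z − y) − G_S(z, y)` is lattice-harmonic on `S` (`−Δ G₀(· − y) = δ_y = −Δ G_S(·, y)` on `S`); the bond shift is
  the discrete gradient at `c` of `w = h_c − h_{c+eⱼ}`, which is harmonic on `S` with boundary values `G₀(z − c) − G₀(z − c − eⱼ) = O(R⁻³)`
  (`LatticeGreenGradient.latticeGreen_gradient_bound`, Lawler (1.36)), hence `|w| = O(R⁻³)` on `S` (maximum principle, `LatticeLaplacianZd`), hence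
  `|w(c + eⱼ) − w(c)| = O(R⁻³/R)` by the interior gradient estimate for lattice-harmonic functions (`WeakCouplingRates.HarmonicInterior.harmonic_gradient_le_centre`,
  Lawler–Limic 6.3.8) — the conducting-cavity image-charge law in `d = 4`;
* **`latticeGFF_bond_covariance_shift_le`** — the same read on the Gaussian measure: for the lattice GFF `latticeGFF β S` (`β > 0`),
  `|β·(Cov(φ_c,φ_c) + Cov(φ_{c'},φ_{c'}) − 2Cov(φ_c,φ_{c'})) − (G(0) − G(eⱼ))| ≤ C/R⁴`, i.e. in the (DR) letters
  `(R⁴/C₁)|β·E[(φ_{c+eⱼ} − φ_c)²] − p| ≤ A₀` with the β-INDEPENDENT reference `p = G(0) − G(eⱼ)` (after the `1/β` rescaling) and `A₀ = C/C₁`, for every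
  region containing the cube — the Gaussian calibration (BC5 rung) of `stub_dirichletRate`, rate `R⁻⁴`, uniformly in the region.

HONEST FRAMING: a statement about the lattice GFF (the one-loop caricature of the cold-wall cube), not about Yang–Mills; nothing of E0′, NT or the gap;
not Clay.
-/

open Finset
open Literature.Probability.LatticeModels
open Literature.MathematicalPhysics.QuantumFieldTheory.LatticeForm (e)
open Summit.QuantumFields.YangMills.Theorems.WeakCouplingRates.HarmonicInterior (harmonic_gradient_le_centre)

noncomputable section

namespace Summit.QuantumFields.YangMills.Cruxes.UVSeamRec.ClassicalResponse.GaussianCalibration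

/-- **The image function is harmonic.**  For `y ∈ S`, `z ↦ G(z − y)/2 − G_S(z, y)` is lattice-harmonic on `S` (`−Δ` of both terms is `δ_y` on `S`).
[cite: Lawler1991, §1.5, p. 29] -/
theorem isZdHarmonicOn_image (S : Finset (Site 4)) (y : Site 4) :
    IsZdHarmonicOn (fun z => latticeGreen (z - y) / 2 - dirichletGreen S z y) (S : Set (Site 4)) := by
  intro z hz
  have hzS : z ∈ S := Finset.mem_coe.1 hz
  show latticeLaplacianZd ((fun z => latticeGreen (z - y) / 2) - fun z => dirichletGreen S z y) z = 0
  rw [latticeLaplacianZd_sub]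
  have h1 := neg_latticeLaplacianZd_half_latticeGreen_sub 4 (by norm_num) y z
  have h2 := neg_latticeLaplacianZd_dirichletGreen_left (by norm_num) S hzS y
  linarith

/-- **THE GAUSSIAN CALIBRATION OF THE DIRICHLET RATE.**  There is `C > 0` such that for every `R ≥ 8`, every finite `S ⊂ ℤ⁴` containing the sup-norm
cube `{z : |z_k − c_k| ≤ R + 1 ∀k}`, and every axis `j`:
`|[G_S(c,c) + G_S(c+eⱼ,c+eⱼ) − 2 G_S(c,c+eⱼ)] − [G(0) − G(eⱼ)]| ≤ C/R⁴` (`G_S = dirichletGreen S`, `G = latticeGreen`). [folklore] -/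
theorem dirichletGreen_bond_shift_le : ∃ C : ℝ, 0 < C ∧ ∀ (R : ℕ), 8 ≤ R → ∀ (S : Finset (Site 4)) (c : Site 4),
    (∀ z : Site 4, (∀ k, |z k - c k| ≤ (R : ℤ) + 1) → z ∈ S) → ∀ j : Fin 4,
    |(dirichletGreen S c c + dirichletGreen S (c + e j) (c + e j) - 2 * dirichletGreen S c (c + e j)) -
        (latticeGreen (0 : Site 4) - latticeGreen (e j))| ≤ C / (R : ℝ) ^ 4 := by
  obtain ⟨Cg, hCg, hgrad⟩ := harmonic_gradient_le_centre
  obtain ⟨K', hK', hG⟩ := latticeGreen_gradient_bound (d := 4) (by norm_num)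
  refine ⟨2 * Cg * K' + 1, by positivity, fun R hR S c hS j => ?_⟩
  have hR0 : (0 : ℝ) < R := by exact_mod_cast (show 0 < R by omega)
  set c' : Site 4 := c + e j with hc'
  -- the harmonic image difference `w = h_c − h_{c'}`
  set w : Site 4 → ℝ := fun z => (latticeGreen (z - c) / 2 - dirichletGreen S z c) -
    (latticeGreen (z - c') / 2 - dirichletGreen S z c') with hw
  have hw_harm : IsZdHarmonicOn w (S : Set (Site 4)) := (isZdHarmonicOn_image S c).sub (isZdHarmonicOn_image S c')
  -- boundary values: `|w z| ≤ M₀ := K'/(2 R³)` off `S`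
  set M₀ : ℝ := K' / (2 * (R : ℝ) ^ 3) with hM₀
  have hM₀0 : 0 ≤ M₀ := by positivity
  have hbdry : ∀ z : Site 4, z ∉ S → |w z| ≤ M₀ := by
    intro z hz
    have hw0 : w z = (latticeGreen (z - c) - latticeGreen (z - c')) / 2 := by
      simp only [hw, dirichletGreen_of_not_mem_left S hz]; ring
    -- `z − c = (z − c') + e j` and `z − c' ≠ 0`, `‖z − c'‖ ≥ R`
    set x : Site 4 := z - c' with hx
    have hxc : z - c = x + Pi.single j 1 := by rw [hx, hc']; simp [e]; abel
    obtain ⟨k, hk⟩ : ∃ k, (R : ℤ) + 1 < |z k - c k| := by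
      by_contra h
      exact hz (hS z fun k => le_of_not_gt fun hk => h ⟨k, hk⟩)
    have hxk : (R : ℤ) ≤ |x k| := by
      have : x k = z k - c k - (Pi.single j (1 : ℤ) : Site 4) k := by simp [hx, hc', e, sub_sub]
      rw [this]
      by_cases hjk : k = j
      · subst hjk; simp; have := abs_sub_abs_le_abs_sub (z k - c k) 1; simp at this; omega
      · rw [Pi.single_eq_of_ne hjk]; simp; omega
    have hx0 : x ≠ 0 := by
      intro h0
      have : x k = 0 := by rw [h0]; rfl
      rw [this] at hxk; simp at hxk; omega
    have hnorm : (R : ℝ) ≤ Real.sqrt (∑ i, ((x i : ℤ) : ℝ) ^ 2) := by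
      have h1 : ((R : ℝ)) ^ 2 ≤ ∑ i, ((x i : ℤ) : ℝ) ^ 2 := by
        have hk' : (R : ℝ) ≤ |((x k : ℤ) : ℝ)| := by
          rw [← Int.cast_abs]; exact_mod_cast hxk
        have h2 : ((x k : ℤ) : ℝ) ^ 2 ≤ ∑ i, ((x i : ℤ) : ℝ) ^ 2 :=
          Finset.single_le_sum (f := fun i => ((x i : ℤ) : ℝ) ^ 2) (fun i _ => sq_nonneg _) (Finset.mem_univ k)
        nlinarith [sq_abs ((x k : ℤ) : ℝ), abs_nonneg ((x k : ℤ) : ℝ)]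
      exact Real.le_sqrt_of_sq_le h1 |> fun h => by simpa [Real.sqrt_sq hR0.le] using Real.sqrt_le_sqrt h1
    have hgx := hG x hx0 j
    rw [← hxc] at hgx
    -- `√(Σ)^{1-4} = (√Σ)⁻³ ≤ R⁻³`
    have hs0 : 0 < Real.sqrt (∑ i, ((x i : ℤ) : ℝ) ^ 2) := lt_of_lt_of_le hR0 hnorm
    have hpow : Real.sqrt (∑ i, ((x i : ℤ) : ℝ) ^ 2) ^ (1 - ((4 : ℕ) : ℝ)) ≤ ((R : ℝ) ^ 3)⁻¹ := by
      have e1 : (1 - ((4 : ℕ) : ℝ)) = -((3 : ℕ) : ℝ) := by norm_num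
      rw [e1, Real.rpow_neg hs0.le, Real.rpow_natCast]
      exact inv_anti₀ (pow_pos hR0 3) (pow_le_pow_left₀ hR0.le hnorm 3)
    rw [hw0, abs_div, abs_two, hM₀]
    have : |latticeGreen (z - c) - latticeGreen x| ≤ K' * ((R : ℝ) ^ 3)⁻¹ := hgx.trans (mul_le_mul_of_nonneg_left hpow hK')
    calc |latticeGreen (z - c) - latticeGreen x| / 2 ≤ K' * ((R : ℝ) ^ 3)⁻¹ / 2 := by gcongr
      _ = K' / (2 * (R : ℝ) ^ 3) := by field_simp
  -- maximum principle: `|w| ≤ M₀` on `S`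
  have hinS : ∀ z ∈ S, |w z| ≤ M₀ := by
    intro z hz
    have hup := hw_harm.subharmonicOn.le_of_forall_boundary_le (by norm_num) S.finite_toSet (M := M₀)
      (fun y hy => (le_abs_self _).trans (hbdry y fun h => hy.1 (Finset.mem_coe.2 h))) z (Finset.mem_coe.2 hz)
    have hlo := hw_harm.superharmonicOn.ge_of_forall_boundary_ge (by norm_num) S.finite_toSet (M := -M₀)
      (fun y hy => (neg_le_neg (hbdry y fun h => hy.1 (Finset.mem_coe.2 h))).trans (neg_abs_le _)) z (Finset.mem_coe.2 hz)
    exact abs_le.2 ⟨hlo, hup⟩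
  have hall : ∀ z : Site 4, |w z| ≤ M₀ := fun z => by
    by_cases hz : z ∈ S
    · exact hinS z hz
    · exact hbdry z hz
  -- interior gradient estimate on the sup-ball of radius `r = R/2` around `c`
  set r : ℕ := R / 2 with hr
  have hr4 : 4 ≤ r := by omega
  have h2r : 2 * (r : ℤ) + 1 ≤ (R : ℤ) + 1 := by omega
  have hharm : ∀ z : Site 4, (∀ k, |z k - c k| < 2 * (r : ℤ)) → latticeLaplacianZd w z = 0 := by
    intro z hz
    exact hw_harm z (Finset.mem_coe.2 (hS z fun k => by have := hz k; omega))
  have hbd : ∀ z : Site 4, (∀ k, |z k - c k| ≤ 2 * (r : ℤ) + 1) → |w z| ≤ M₀ := fun z _ => hall z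
  have hkey := hgrad r hr4 w c M₀ hharm hbd c (fun k => by simp) j
  -- the bond shift is `w(c + e j) − w(c)`
  have hid : (dirichletGreen S c c + dirichletGreen S (c + e j) (c + e j) - 2 * dirichletGreen S c (c + e j)) -
      (latticeGreen (0 : Site 4) - latticeGreen (e j)) = w (c + e j) - w c := by
    simp only [hw, hc', sub_self, add_sub_cancel_left]
    have e1 : c - (c + e j) = -(e j : Site 4) := by abel
    rw [e1, latticeGreen_neg, dirichletGreen_comm S (c + e j) c]
    ring
  rw [hid]
  -- `Cg · M₀ / r ≤ (2 Cg K' + 1)/R⁴`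
  have hrR : (R : ℝ) ≤ 4 * (r : ℝ) := by
    have : R ≤ 4 * r := by omega
    exact_mod_cast this
  have hrpos : (0 : ℝ) < r := by exact_mod_cast (show 0 < r by omega)
  calc |w (c + e j) - w c| ≤ Cg * M₀ / r := hkey
    _ = Cg * K' / (2 * (R : ℝ) ^ 3 * r) := by rw [hM₀]; field_simp
    _ ≤ Cg * K' / (2 * (R : ℝ) ^ 3 * ((R : ℝ) / 4)) := by
        apply div_le_div_of_nonneg_left (by positivity) (by positivity)
        have : (R : ℝ) / 4 ≤ r := by linarith
        exact mul_le_mul_of_nonneg_left this (by positivity)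
    _ = 2 * Cg * K' / (R : ℝ) ^ 4 := by field_simp; ring
    _ ≤ (2 * Cg * K' + 1) / (R : ℝ) ^ 4 := by gcongr; linarith

/-- **The same read on the Gaussian measure.**  For the massless lattice GFF with zero boundary condition outside `S` at inverse temperature `β > 0`
(`latticeGFF β S`, covariance `β⁻¹ G_S`), `R ≥ 8`, `S ⊇` the sup-norm cube of radius `R + 1` around `c`, and `c, c + eⱼ ∈ S`:
`|β·(Cov(φ_c, φ_c) + Cov(φ_{c+eⱼ}, φ_{c+eⱼ}) − 2 Cov(φ_c, φ_{c+eⱼ})) − (G(0) − G(eⱼ))| ≤ C/R⁴` — the Dirichlet finite-size law of the bond variance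
(`= β·E[(φ_{c+eⱼ} − φ_c)²]`) has rate `R⁻⁴` with a β-independent reference, uniformly in the region: the Gaussian calibration of `stub_dirichletRate`.
[cite: GlimmJaffe1987, Prop. 7.8.5 (7.8.18)] -/
theorem latticeGFF_bond_covariance_shift_le : ∃ C : ℝ, 0 < C ∧ ∀ (R : ℕ), 8 ≤ R → ∀ (S : Finset (Site 4)) (c : Site 4)
    (hS : ∀ z : Site 4, (∀ k, |z k - c k| ≤ (R : ℤ) + 1) → z ∈ S) (j : Fin 4) {β : ℝ}, 0 < β →
    ∀ (hc : c ∈ S) (hc' : c + e j ∈ S),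
    |β * (ProbabilityTheory.covariance (fun φ : EuclideanSpace ℝ S => φ ⟨c, hc⟩) (fun φ => φ ⟨c, hc⟩) (latticeGFF β S) +
        ProbabilityTheory.covariance (fun φ : EuclideanSpace ℝ S => φ ⟨c + e j, hc'⟩) (fun φ => φ ⟨c + e j, hc'⟩) (latticeGFF β S) -
        2 * ProbabilityTheory.covariance (fun φ : EuclideanSpace ℝ S => φ ⟨c, hc⟩) (fun φ => φ ⟨c + e j, hc'⟩) (latticeGFF β S)) -
      (latticeGreen (0 : Site 4) - latticeGreen (e j))| ≤ C / (R : ℝ) ^ 4 := by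
  obtain ⟨C, hC, h⟩ := dirichletGreen_bond_shift_le
  refine ⟨C, hC, fun R hR S c hS j β hβ hc hc' => ?_⟩
  have h1 := covariance_latticeGFF (d := 4) (by norm_num) hβ.le S ⟨c, hc⟩ ⟨c, hc⟩
  have h2 := covariance_latticeGFF (d := 4) (by norm_num) hβ.le S ⟨c + e j, hc'⟩ ⟨c + e j, hc'⟩
  have h3 := covariance_latticeGFF (d := 4) (by norm_num) hβ.le S ⟨c, hc⟩ ⟨c + e j, hc'⟩
  have e1 : (fun φ : EuclideanSpace ℝ S => φ ⟨c, hc⟩) = fun φ : EuclideanSpace ℝ S => WithLp.ofLp φ ⟨c, hc⟩ := rfl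
  have e2 : (fun φ : EuclideanSpace ℝ S => φ ⟨c + e j, hc'⟩) = fun φ : EuclideanSpace ℝ S => WithLp.ofLp φ ⟨c + e j, hc'⟩ := rfl
  rw [e1, e2, h1, h2, h3]
  have : β * (β⁻¹ * dirichletGreen S c c + β⁻¹ * dirichletGreen S (c + e j) (c + e j) - 2 * (β⁻¹ * dirichletGreen S c (c + e j))) =
      dirichletGreen S c c + dirichletGreen S (c + e j) (c + e j) - 2 * dirichletGreen S c (c + e j) := by
    field_simp
  rw [this]
  exact h R hR S c hS j

end Summit.QuantumFields.YangMills.Cruxes.UVSeamRec.ClassicalResponse.GaussianCalibration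

end
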